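import Summits.Ventures.Crystal3D.Theorems.StickyWulffConstantGenericWallFloorBarlowLineCountOneSided
import Summits.Ventures.Crystal3D.Theorems.StickyWulffConstantGenericWallFloorBarlowOrientedGlueApart
import HarnessLib

/-!
# F4 glue for ONE up-presented plate with a CHOSEN reference upper slot `v` (not necessarily the steepest), clause (i) alone
# (crux `GenericWallFloor`, stmt-Ventures-19480, line `WallLedgerG`; lane T row (e) `stub_residualFaulted`, cf-p1 (lxxxviii)/(xc)/(xciii), K1a
# «chosen family» of HOME/wall-p2-g10/FAULTED-LEDGER-MEMO.md)

HONEST FRAMING. Venture `Summits/Ventures/Crystal3D` (cell `crystal3d-full`), helper `--supports` the crux `GenericWallFloor`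
(stmt-Ventures-19480) of `route-Ventures-StickyWulffConstant`, registered line `WallLedgerG`.  Rung credit only; F-C1 not moved; NOT the
stub.  Inputs BY NAME: E1 (`ExactOnly`), `DoubleStarCoaxialAt` / `CapPairCoaxial`.

Row (e) is where the CANONICAL family (slot `famSlot` = the steepest reference upper slot) is read by the other plate; the cure of lane G is to
CHOOSE another slot.  `barlow_hlines_oriented_oneSided` (…BarlowOrientedGlueOneSided) is the canonical-slot glue; this file is the same
glue for ANY of the three reference upper slots `v` of the up-presented bottom plate that is steep (`⟪L₁v, e₃⟫ ≥ √2/2`): machine steps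
`ms m = v` on Δ-bilayers, `basalMirror (bestCapper G₁ (L₁e₃) e₃)` on ∇-bilayers (v-independent), canonical depth-1/2 states, rise floor
`δ = 1/4` (Δ: `⟪L₁v,e₃⟫ ≥ √2/2`; ∇: `bilayerRise ≥ 1/4`), hypothesis `hapart₁` = clause (i) of `FramesApart` for `chainFrames e₃ L₁ v` only.
Since lane T's `IsZigSelector` hard-codes the rise `bilayerRise` (the steepest slot), the polyline is delivered with its e-UPWARD-BOND
property and its step values instead (`IsUpBond` on every bilayer, `= v` on Δ-bilayers, rise `= bilayerRise` on ∇-bilayers) — enough for a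
T-side `plateFluxAt v` glue (wulff-p2, cf-p1 (xciii)(5)).
* `isUpBond_machineStep_at` — the machine steps with a chosen Δ-slot are e-upward bonds (lane T's normal form);
* `zigVertexS_mem_barlowLayer_of_upBond` — an `IsUpBond` step sequence of an up-presented plate has its polyline on the layers;
* **`barlow_hlines_oriented_oneSided_at`** — the one-family `hlines` inner shape for the chosen slot `v`, `C_w = 318 + 192R₀`.
WHAT THIS IS NOT: not the T-side cell inequality; not the `axisSign = −1` presentation; F-C1 not moved.
-/

noncomputable section

namespace Summit.Ventures.Crystal3D.Theorems

open Finset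
open Literature.MathematicalPhysics.StatisticalMechanics
open Summit.Ventures.Crystal3D.Cruxes.TextureLiminf.TexShadow (stacking cyl upSlot₁ upSlot₂ upSlot₃ bilayerRise)
open scoped InnerProductSpace

section Oriented

variable (σ : ℤ → ℤ) (L : EuclideanSpace ℝ (Fin 3) ≃ₗᵢ[ℝ] EuclideanSpace ℝ (Fin 3)) (e v : EuclideanSpace ℝ (Fin 3))
  (ms : ℤ → EuclideanSpace ℝ (Fin 3))

/-- **Machine steps with a CHOSEN Δ-slot are e-upward bonds** (lane T's normal form `IsUpBond`, orientation `axisSign = +1`). -/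
theorem isUpBond_machineStep_at (hσ : IsHaggSeq σ) (hax : 0 ≤ (L.symm e) 2)
    (hv : v ∈ fccSlots) (hv2 : v 2 = Real.sqrt (2 / 3))
    (hms₁ : ∀ m, σ m = 1 → ms m = v)
    (hms₂ : ∀ m, σ m = -1 → ms m =
      basalMirror (bestCapper (twinFrame L (L (EuclideanSpace.single (2 : Fin 3) (1 : ℝ)))) (L (EuclideanSpace.single (2 : Fin 3) (1 : ℝ))) e))
    (m : ℤ) : IsUpBond L σ e m (ms m) := by
  have hax1 : axisSign L e = 1 := by simp [axisSign, hax]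
  rcases hσ m with hm | hm
  · -- Δ: the chosen slot is a reference upper slot
    rcases eq_upSlot_of_apply_two hv hv2 with h | h | h
    · exact ⟨0, 0, Or.inl ⟨rfl, rfl⟩, by rw [hms₁ m hm, h, hax1, one_smul, if_pos hm]; rfl⟩
    · exact ⟨-1, 0, Or.inr (Or.inl ⟨rfl, rfl⟩), by rw [hms₁ m hm, h, hax1, one_smul, if_pos hm]; rfl⟩
    · exact ⟨0, -1, Or.inr (Or.inr ⟨rfl, rfl⟩), by rw [hms₁ m hm, h, hax1, one_smul, if_pos hm]; rfl⟩
  · -- ∇: the best capper is the negative of a reference upper slot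
    obtain ⟨hq, hq2⟩ := bestCapper_nabla_slot L e
    have hm' : ¬ σ m = 1 := by rw [hm]; decide
    have hneg := eq_upSlot_of_apply_two (neg_mem_fccSlots hq) (by simp [hq2])
    have key : ∀ w : EuclideanSpace ℝ (Fin 3),
        -bestCapper (twinFrame L (L (EuclideanSpace.single (2 : Fin 3) (1 : ℝ)))) (L (EuclideanSpace.single (2 : Fin 3) (1 : ℝ))) e = w →
        ms m = axisSign L e • (if σ m = 1 then w else basalMirror (-w)) := by
      intro w hw
      rw [hms₂ m hm, hax1, one_smul, if_neg hm', ← hw, neg_neg]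
    rcases hneg with h | h | h
    · exact ⟨0, 0, Or.inl ⟨rfl, rfl⟩, key _ h⟩
    · exact ⟨-1, 0, Or.inr (Or.inl ⟨rfl, rfl⟩), key _ h⟩
    · exact ⟨0, -1, Or.inr (Or.inr ⟨rfl, rfl⟩), key _ h⟩

end Oriented

/-- **An `IsUpBond` step sequence of an up-presented plate has its polyline on the layers**: vertex `k` of `zigVertexS step` is a site of
layer `k` (the `IsUpBond` half of `zigVertexS_mem_barlowLayer`, which asks for a full `IsZigSelector`). -/
theorem zigVertexS_mem_barlowLayer_of_upBond (L : EuclideanSpace ℝ (Fin 3) ≃ₗᵢ[ℝ] EuclideanSpace ℝ (Fin 3)) {σ : ℤ → ℤ}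
    (hσ : IsHaggSeq σ) (e : EuclideanSpace ℝ (Fin 3)) (hax : 0 ≤ (L.symm e) 2) {step : ℤ → EuclideanSpace ℝ (Fin 3)}
    (hup : ∀ k : ℤ, IsUpBond L σ e k (step k)) (k : ℤ) :
    zigVertexS step k ∈ barlowLayer 1 (Real.sqrt (2 / 3)) σ k := by
  have hfb : ∀ n : ℕ, zigFwdS step n ∈ barlowLayer 1 (Real.sqrt (2 / 3)) σ n ∧
      zigBwdS step n ∈ barlowLayer 1 (Real.sqrt (2 / 3)) σ (-(n : ℤ)) := by
    intro n
    induction n with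
    | zero =>
      rw [Nat.cast_zero, neg_zero]
      exact ⟨zero_mem_barlowLayer_zero' σ, zero_mem_barlowLayer_zero' σ⟩
    | succ n ih =>
      obtain ⟨ihf, ihb⟩ := ih
      constructor
      · show zigFwdS step n + step n ∈ _
        have h := ((hup n).add_mem_barlowLayer hσ (zigFwdS step n)).1 hax ihf
        rw [show (((n + 1 : ℕ) : ℤ)) = (n : ℤ) + 1 by push_cast; rfl]
        exact h
      · show zigBwdS step n - step (-((n : ℤ) + 1)) ∈ _
        have h := ((hup (-((n : ℤ) + 1))).sub_mem_barlowLayer hσ (zigBwdS step n)).1 hax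
        rw [show (-((n : ℤ) + 1) + 1) = -(n : ℤ) by ring] at h
        rw [show (-((n + 1 : ℕ) : ℤ)) = -((n : ℤ) + 1) by push_cast; ring]
        exact h ihb
  rcases le_or_gt 0 k with hk | hk
  · obtain ⟨n, rfl⟩ := Int.eq_ofNat_of_zero_le hk
    simp only [zigVertexS, Int.natCast_nonneg, if_true, Int.toNat_natCast]
    exact (hfb n).1
  · obtain ⟨n, rfl⟩ : ∃ n : ℕ, k = -(n : ℤ) := ⟨(-k).toNat, by omega⟩
    have h1 : ¬ (0 : ℤ) ≤ -(n : ℤ) := by omega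
    simp only [zigVertexS, h1, if_false, neg_neg, Int.toNat_natCast]
    exact (hfb n).2

/-- **F4 glue for ONE up-presented plate with a CHOSEN steep reference upper slot `v`, clause (i) only.**  See the module docstring. -/
theorem barlow_hlines_oriented_oneSided_at
    {sE : EuclideanSpace ℝ (Fin 3)} (hsE : sE ∈ fccSlots) (hcert : ExactOnly 0 (fccSlots.filter fun w => 0 < ⟪w, sE⟫_ℝ))
    (hDS : ∀ F₁ F₂ : EuclideanSpace ℝ (Fin 3) ≃ₗᵢ[ℝ] EuclideanSpace ℝ (Fin 3), DoubleStarCoaxialAt F₁ F₂) (hCP : CapPairCoaxial)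
    {σ₁ σ₂ : ℤ → ℤ} (hσ₁ : IsHaggSeq σ₁) (hσ₂ : IsHaggSeq σ₂)
    (L₁ L₂ : EuclideanSpace ℝ (Fin 3) ≃ₗᵢ[ℝ] EuclideanSpace ℝ (Fin 3)) (s₁ s₂ : EuclideanSpace ℝ (Fin 3))
    (hax₁ : 0 ≤ (L₁.symm (EuclideanSpace.single (2 : Fin 3) (1 : ℝ))) 2)
    {v : EuclideanSpace ℝ (Fin 3)} (hv : v ∈ fccSlots) (hv2 : v 2 = Real.sqrt (2 / 3))
    (hsteep₁ : Real.sqrt 2 / 2 ≤ ⟪L₁ v, EuclideanSpace.single (2 : Fin 3) (1 : ℝ)⟫_ℝ)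
    (hapart₁ : ∀ F ∈ chainFrames (EuclideanSpace.single (2 : Fin 3) (1 : ℝ)) L₁ v,
      F '' fccStacking 1 (Real.sqrt (2 / 3)) ≠ L₂ '' fccStacking 1 (Real.sqrt (2 / 3)) ∧
      F '' fccStacking 1 (Real.sqrt (2 / 3)) ≠
        (twinFrame L₂ (L₂ (EuclideanSpace.single (2 : Fin 3) (1 : ℝ)))) '' fccStacking 1 (Real.sqrt (2 / 3)))
    (R₀ : ℝ) (hR₀ : 6 ≤ R₀) :
    ∃ step₁ : ℤ → EuclideanSpace ℝ (Fin 3),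
      (∀ k, IsUpBond L₁ σ₁ (EuclideanSpace.single (2 : Fin 3) (1 : ℝ)) k (step₁ k)) ∧
      (∀ k, σ₁ k = 1 → step₁ k = v) ∧
      (∀ k, σ₁ k = -1 → ⟪step₁ k, L₁.symm (EuclideanSpace.single (2 : Fin 3) (1 : ℝ))⟫_ℝ =
        bilayerRise L₁ σ₁ (EuclideanSpace.single (2 : Fin 3) (1 : ℝ)) k) ∧
      ∀ h : ℝ, 0 ≤ h → ∀ ρ : ℝ, R₀ ≤ ρ → ∀ X P₁ P₂ : Finset (EuclideanSpace ℝ (Fin 3)),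
      (∀ p ∈ X, ∀ q ∈ X, p ≠ q → 1 ≤ dist p q) → P₁ ⊆ X → P₂ ⊆ X \ P₁ → (∀ p ∈ X, p ∈ cyl R₀ h ρ) →
      (∀ p, p ∈ P₁ ↔ (p ∈ stacking L₁ s₁ σ₁ ∧ -(2 * R₀) ≤ p 2 ∧ p 2 ≤ -R₀ ∧ p 0 ^ 2 + p 1 ^ 2 ≤ ρ ^ 2)) →
      (∀ p, p ∈ P₂ ↔ (p ∈ stacking L₂ s₂ σ₂ ∧ h + R₀ ≤ p 2 ∧ p 2 ≤ h + 2 * R₀ ∧ p 0 ^ 2 + p 1 ^ 2 ≤ ρ ^ 2)) →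
      ∃ (m : ℝ) (T₁ : Finset (Fin 2 → ℤ)), 0 ≤ m ∧
        (∀ t : Fin 2 → ℤ, (∃ k : ℤ,
          -R₀ - 4 ≤ (L₁ (zigVertexS step₁ k + ((t 0 : ℝ) • triangularVec₁ 1 + (t 1 : ℝ) • triangularVec₂ 1)) + s₁) 2 ∧
          (L₁ (zigVertexS step₁ k + ((t 0 : ℝ) • triangularVec₁ 1 + (t 1 : ℝ) • triangularVec₂ 1)) + s₁) 2 ≤ -R₀ - 3 ∧
          Real.sqrt ((L₁ (zigVertexS step₁ k + ((t 0 : ℝ) • triangularVec₁ 1 + (t 1 : ℝ) • triangularVec₂ 1)) + s₁) 0 ^ 2 +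
            (L₁ (zigVertexS step₁ k + ((t 0 : ℝ) • triangularVec₁ 1 + (t 1 : ℝ) • triangularVec₂ 1)) + s₁) 1 ^ 2) ≤ ρ - m) →
          t ∈ T₁) ∧
        (T₁.card : ℝ) + 18 * m * ρ ≤
          (∑ y ∈ X.filter (fun y => (X.filter fun q => dist y q = 1).card ≠ 12 ∧ -R₀ - 2 ≤ y 2 ∧ y 2 ≤ h + R₀ + 2),
            ((12 : ℝ) - ((X.filter fun q => dist y q = 1).card : ℝ))) + (318 + 192 * R₀) * (1 + h) * ρ := by
  set e₃ : EuclideanSpace ℝ (Fin 3) := EuclideanSpace.single (2 : Fin 3) (1 : ℝ) with he₃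
  have he₃n : ‖e₃‖ = 1 := by rw [he₃, PiLp.norm_single, norm_one]
  -- the ∇ slot, machine steps, canonical states
  set G₁ := twinFrame L₁ (L₁ e₃) with hG₁
  set q₁ := bestCapper G₁ (L₁ e₃) e₃ with hq₁
  set ms₁ : ℤ → EuclideanSpace ℝ (Fin 3) := fun m => if σ₁ m = 1 then v else basalMirror q₁ with hms₁
  set canon₁ : ℤ → EuclideanSpace ℝ (Fin 3) → EuclideanSpace ℝ (Fin 3) × List WalkEntry :=
    fun m t => if σ₁ (m - 1) = 1 then (t, [⟨L₁, v, 0⟩]) else (t, [⟨G₁, q₁, L₁ e₃⟩, ⟨L₁, v, 0⟩]) with hcanon₁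
  have hne : ¬ ((-1 : ℤ) = 1) := by decide
  have hms₁₁ : ∀ m, σ₁ m = 1 → ms₁ m = v := fun m hm => by simp only [hms₁, hm, if_true]
  have hms₁₂ : ∀ m, σ₁ m = -1 → ms₁ m = basalMirror q₁ := fun m hm => by simp only [hms₁, hm, hne, if_false]
  have hcanon₁₁ : ∀ m t, σ₁ (m - 1) = 1 → canon₁ m t = (t, [⟨L₁, v, 0⟩]) := fun m t hm => by simp only [hcanon₁, hm, if_true]
  have hcanon₁₂ : ∀ m t, σ₁ (m - 1) = -1 → canon₁ m t = (t, [⟨G₁, q₁, L₁ e₃⟩, ⟨L₁, v, 0⟩]) := fun m t hm => by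
    simp only [hcanon₁, hm, hne, if_false]
  have hup : ∀ k, IsUpBond L₁ σ₁ e₃ k (ms₁ k) := isUpBond_machineStep_at σ₁ L₁ e₃ v ms₁ hσ₁ hax₁ hv hv2 hms₁₁ hms₁₂
  have hrise : ∀ k, σ₁ k = -1 → ⟪ms₁ k, L₁.symm e₃⟫_ℝ = bilayerRise L₁ σ₁ e₃ k := by
    intro k hk
    rw [hms₁₂ k hk]
    exact inner_basalMirror_bestCapper σ₁ L₁ e₃ hax₁ k hk
  refine ⟨ms₁, hup, hms₁₁, hrise, ?_⟩
  intro h hh ρ hρ X P₁ P₂ hX hP₁X hP₂X' hcyl hP₁ hP₂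
  have hP₂X : P₂ ⊆ X := hP₂X'.trans Finset.sdiff_subset
  have hcell : ∀ p ∈ X, -(2 * R₀) ≤ p 2 ∧ p 2 ≤ h + 2 * R₀ ∧ p 0 ^ 2 + p 1 ^ 2 ≤ ρ ^ 2 := fun p hp => by
    have := hcyl p hp; simpa only [cyl, Set.mem_setOf_eq] using this
  -- rise floor 1/4 on both bilayer signs
  have hs22 : (1 / 4 : ℝ) ≤ Real.sqrt 2 / 2 := by
    have : (1 : ℝ) ≤ Real.sqrt 2 := by
      rw [show (1 : ℝ) = Real.sqrt 1 by rw [Real.sqrt_one]]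
      exact Real.sqrt_le_sqrt (by norm_num)
    linarith
  have hδ₁ : ∀ m, (1 / 4 : ℝ) ≤ ⟪L₁ (ms₁ m), e₃⟫_ℝ := by
    intro m
    rcases hσ₁ m with hm | hm
    · rw [hms₁₁ m hm]; exact hs22.trans hsteep₁
    · rw [inner_map_eq_inner_symm, hrise m hm]; exact quarter_le_bilayerRise L₁ σ₁ he₃n m
  -- the polyline
  have hsucc₁ : ∀ k, zigVertexS ms₁ (k + 1) = zigVertexS ms₁ k + ms₁ k := fun k => zigVertexS_succ ms₁ k
  have hlayer₁ : ∀ k, zigVertexS ms₁ k ∈ barlowLayer 1 (Real.sqrt (2 / 3)) σ₁ k :=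
    zigVertexS_mem_barlowLayer_of_upBond L₁ hσ₁ e₃ hax₁ hup
  -- the line count with explicit margin
  have hq : (1 : ℝ) / 4 > 0 := by norm_num
  obtain ⟨T₁, hT₁, hcount⟩ := barlow_lineCount_le_payers_oneSided hX hsE hcert hDS hCP hσ₁ hσ₂ L₁ L₂ s₁ s₂ R₀ h ρ hR₀ hh
    (by linarith) P₁ P₂ hP₁X hP₂X hcell hP₁ hP₂ v canon₁ ms₁ hv hv2 hsteep₁ hcanon₁₁ hcanon₁₂ hms₁₁ hms₁₂ hq hδ₁ hapart₁
    (zigVertexS ms₁) hsucc₁ hlayer₁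
  set m : ℝ := 3 + 8 / 3 * (h + 4 * R₀) + 3 / (1 / 4) with hm
  have hmval : m = 15 + 8 / 3 * h + 32 / 3 * R₀ := by rw [hm]; ring
  have hm0 : 0 ≤ m := by rw [hmval]; nlinarith
  have hρ0 : 0 ≤ ρ := by linarith
  refine ⟨m, T₁, hm0, hT₁, ?_⟩
  have hpen : 18 * m * ρ ≤ (318 + 192 * R₀) * (1 + h) * ρ := by
    rw [hmval]
    have h1 : 18 * (15 + 8 / 3 * h + 32 / 3 * R₀) ≤ (318 + 192 * R₀) * (1 + h) := by nlinarith
    exact mul_le_mul_of_nonneg_right h1 hρ0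
  linarith

end Summit.Ventures.Crystal3D.Theorems

end
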